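import Mathlib
import HarnessLib

/-!
# Exact identities of the Burgers swirl layer (radial part of the `Γ`-equation)

New elementary mathematics supporting the soloist analysis of the axisymmetric Navier–Stokes
`Γ`-equation `∂ₜΓ + b·∇Γ = LΓ`, `L = ∂ᵣᵣ − (1/r)∂ᵣ + ∂_zz` (`Γ = r u_θ`), restricted to `z`-independent
profiles, where `L` reduces to the radial operator `radialOp f r = f''(r) − f'(r)/r`.

Content (all statements are one-variable calculus identities over `ℝ`, kernel-checked; sources: the
Burgers vortex, J. M. Burgers, *Adv. Appl. Mech.* 1 (1948) 171–199, for the steady state; the sub/super-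
solution bracket, the logistic law and the `ρ = r²` calculus are this seat's bookkeeping, HOME paper
`c10-located-barrier.md` §3.1):

* `gaussLayer β r = 1 − exp(−β r²/2)`, its first and second radial derivatives, `0 ≤ gaussLayer ≤ 1` for `β ≥ 0`;
* `radialOp (gaussLayer β) r = −β² r² exp(−β r²/2)` (`r ≠ 0`);
* STRAIN RESIDUAL: under the radial strain drift `b_r = −a r` the transport–diffusion residual of `gaussLayer β` is
  `(−a r)·∂ᵣ − radialOp = β(β − a) r² exp(−β r²/2)`; hence the Burgers vortex `β = a` is an exact steady solution,
  `β ≤ a` gives a subsolution (`≤ 0`) and `β ≥ a` a supersolution (`≥ 0`) when `β ≥ 0`;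
* LOGISTIC BRACKET: for a time-dependent width parameter `β(t)` the full residual
  `∂ₜ + (−a r)∂ᵣ − radialOp` of `gaussLayer (β t)` equals `r² exp(−β r²/2)·(β'/2 − aβ + β²)`, nonpositive whenever
  `β' ≤ 2β(a − β)`;
* `ρ = r²` CALCULUS: `radialOp (f ∘ (·)²) r = 4 r² f''(r²)`, and the planar sink drift `b_r = −N²/r` transports
  functions of `r² + 2N²t` exactly.

No Navier–Stokes object of the library is used; this file is the algebraic core of a comparison architecture and
makes no claim about solutions of the Navier–Stokes equations. The linter option `linter.dupNamespace` is disabled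
because the mandated landing namespace `Summit.NavierStokesRegularity.NavierStokesRegularity.Theorems` (single-conjunct
summit, D-0017) repeats the summit name by design. [problem: ns]
-/

set_option linter.dupNamespace false

namespace Summit.NavierStokesRegularity.NavierStokesRegularity.Theorems

open Real

noncomputable section

/-- The Gaussian (Burgers) swirl-layer profile `g_β(r) = 1 − exp(−β r²/2)`; for `β = a > 0` it is the circulation
profile `Γ/Γ_∞` of the Burgers vortex with strain rate `a` and unit viscosity (Burgers 1948). [problem: ns] -/
def gaussLayer (β r : ℝ) : ℝ := 1 - Real.exp (-(β * r ^ 2 / 2))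

/-- The radial part of the operator `L = ∂ᵣᵣ − (1/r)∂ᵣ + ∂_zz` of the axisymmetric `Γ`-equation acting on a
`z`-independent profile `f`: `radialOp f r = f''(r) − f'(r)/r` (junk value `f''(0)` at `r = 0`, never used). [problem: ns] -/
def radialOp (f : ℝ → ℝ) (r : ℝ) : ℝ := deriv (deriv f) r - deriv f r / r

/-- Derivative of the exponent `r ↦ −(β r²/2)`: it is `−(β r)`. -/
theorem hasDerivAt_exponent (β r : ℝ) :
    HasDerivAt (fun x : ℝ => -(β * x ^ 2 / 2)) (-(β * r)) r := by
  have h1 : HasDerivAt (fun x : ℝ => x ^ 2) (2 * r) r := by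
    simpa using hasDerivAt_pow 2 r
  have h2 : HasDerivAt (fun x : ℝ => -(β * x ^ 2 / 2)) (-(β * (2 * r) / 2)) r :=
    ((h1.const_mul β).div_const 2).neg
  exact h2.congr_deriv (by ring)

/-- Derivative of the Gaussian factor `r ↦ exp(−β r²/2)`: `−β r exp(−β r²/2)`. -/
theorem hasDerivAt_expFactor (β r : ℝ) :
    HasDerivAt (fun x : ℝ => Real.exp (-(β * x ^ 2 / 2))) (-(β * r) * Real.exp (-(β * r ^ 2 / 2))) r := by
  have h : HasDerivAt (fun x : ℝ => Real.exp (-(β * x ^ 2 / 2)))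
      (Real.exp (-(β * r ^ 2 / 2)) * (-(β * r))) r := (hasDerivAt_exponent β r).exp
  exact h.congr_deriv (by ring)

/-- First radial derivative of the layer: `∂ᵣ g_β(r) = β r exp(−β r²/2)`. -/
theorem hasDerivAt_gaussLayer (β r : ℝ) :
    HasDerivAt (gaussLayer β) (β * r * Real.exp (-(β * r ^ 2 / 2))) r := by
  have h : HasDerivAt (fun x : ℝ => 1 - Real.exp (-(β * x ^ 2 / 2)))
      (-(-(β * r) * Real.exp (-(β * r ^ 2 / 2)))) r := (hasDerivAt_expFactor β r).const_sub 1
  have h' : HasDerivAt (gaussLayer β) (-(-(β * r) * Real.exp (-(β * r ^ 2 / 2)))) r := h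
  exact h'.congr_deriv (by ring)

/-- `deriv` form of `hasDerivAt_gaussLayer`, as an identity of functions. -/
theorem deriv_gaussLayer (β : ℝ) :
    deriv (gaussLayer β) = fun r => β * r * Real.exp (-(β * r ^ 2 / 2)) := by
  funext r
  exact (hasDerivAt_gaussLayer β r).deriv

/-- Second radial derivative of the layer: `∂ᵣᵣ g_β(r) = β (1 − β r²) exp(−β r²/2)`. -/
theorem hasDerivAt_deriv_gaussLayer (β r : ℝ) :
    HasDerivAt (deriv (gaussLayer β)) (β * (1 - β * r ^ 2) * Real.exp (-(β * r ^ 2 / 2))) r := by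
  rw [deriv_gaussLayer]
  have hlin : HasDerivAt (fun x : ℝ => β * x) β r := by
    simpa using (hasDerivAt_id' r).const_mul β
  have h : HasDerivAt (fun x : ℝ => β * x * Real.exp (-(β * x ^ 2 / 2)))
      (β * Real.exp (-(β * r ^ 2 / 2)) + β * r * (-(β * r) * Real.exp (-(β * r ^ 2 / 2)))) r :=
    hlin.mul (hasDerivAt_expFactor β r)
  exact h.congr_deriv (by ring)

/-- `deriv` form of the second derivative. -/
theorem deriv_deriv_gaussLayer (β r : ℝ) :
    deriv (deriv (gaussLayer β)) r = β * (1 - β * r ^ 2) * Real.exp (-(β * r ^ 2 / 2)) :=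
  (hasDerivAt_deriv_gaussLayer β r).deriv

/-- The radial operator on the layer: `L g_β = −β² r² exp(−β r²/2)` away from the axis. -/
theorem radialOp_gaussLayer (β r : ℝ) (hr : r ≠ 0) :
    radialOp (gaussLayer β) r = -(β ^ 2 * r ^ 2 * Real.exp (-(β * r ^ 2 / 2))) := by
  unfold radialOp
  rw [deriv_deriv_gaussLayer, deriv_gaussLayer]
  field_simp
  ring

/-- STRAIN RESIDUAL. Under the radial strain drift `b_r = −a r` the residual `b_r ∂ᵣ g_β − L g_β` equals
`β(β − a) r² exp(−β r²/2)` (`r ≠ 0`). -/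
theorem strainResidual_gaussLayer (a β r : ℝ) (hr : r ≠ 0) :
    (-(a * r)) * deriv (gaussLayer β) r - radialOp (gaussLayer β) r
      = β * (β - a) * r ^ 2 * Real.exp (-(β * r ^ 2 / 2)) := by
  rw [radialOp_gaussLayer β r hr, deriv_gaussLayer]
  ring

/-- BURGERS VORTEX. `g_a` is an exact steady solution of the radial `Γ`-equation with strain drift `−a r`:
`(−a r) ∂ᵣ g_a − L g_a = 0` (Burgers 1948). -/
theorem burgersVortex_steady (a r : ℝ) (hr : r ≠ 0) :
    (-(a * r)) * deriv (gaussLayer a) r - radialOp (gaussLayer a) r = 0 := by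
  rw [strainResidual_gaussLayer a a r hr]
  ring

/-- SUBSOLUTION: for `0 ≤ β ≤ a` the layer `g_β` is a subsolution (residual `≤ 0`) under strain `a`. -/
theorem strainResidual_nonpos (a β r : ℝ) (hr : r ≠ 0) (hβ : 0 ≤ β) (hβa : β ≤ a) :
    (-(a * r)) * deriv (gaussLayer β) r - radialOp (gaussLayer β) r ≤ 0 := by
  rw [strainResidual_gaussLayer a β r hr]
  have he : 0 < Real.exp (-(β * r ^ 2 / 2)) := Real.exp_pos _
  have h1 : β * (β - a) ≤ 0 := mul_nonpos_of_nonneg_of_nonpos hβ (by linarith)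
  have h2 : 0 ≤ r ^ 2 * Real.exp (-(β * r ^ 2 / 2)) := by positivity
  calc β * (β - a) * r ^ 2 * Real.exp (-(β * r ^ 2 / 2))
      = (β * (β - a)) * (r ^ 2 * Real.exp (-(β * r ^ 2 / 2))) := by ring
    _ ≤ 0 := mul_nonpos_of_nonpos_of_nonneg h1 h2

/-- SUPERSOLUTION: for `0 ≤ a ≤ β` the layer `g_β` is a supersolution (residual `≥ 0`) under strain `a`. -/
theorem strainResidual_nonneg (a β r : ℝ) (hr : r ≠ 0) (hβ : 0 ≤ β) (haβ : a ≤ β) :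
    0 ≤ (-(a * r)) * deriv (gaussLayer β) r - radialOp (gaussLayer β) r := by
  rw [strainResidual_gaussLayer a β r hr]
  have h1 : 0 ≤ β * (β - a) := mul_nonneg hβ (by linarith)
  positivity

/-- Derivative of the layer in the WIDTH parameter: `∂_β g_β(r) = (r²/2) exp(−β r²/2)`. -/
theorem hasDerivAt_gaussLayer_param (β r : ℝ) :
    HasDerivAt (fun b : ℝ => gaussLayer b r) (r ^ 2 / 2 * Real.exp (-(β * r ^ 2 / 2))) β := by
  have h0' : HasDerivAt (fun b : ℝ => -(b * r ^ 2 / 2)) (-(1 * r ^ 2 / 2)) β :=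
    (((hasDerivAt_id' β).mul_const (r ^ 2)).div_const 2).neg
  have h0 : HasDerivAt (fun b : ℝ => -(b * r ^ 2 / 2)) (-(r ^ 2 / 2)) β := h0'.congr_deriv (by ring)
  have h : HasDerivAt (fun b : ℝ => 1 - Real.exp (-(b * r ^ 2 / 2)))
      (-(Real.exp (-(β * r ^ 2 / 2)) * (-(r ^ 2 / 2)))) β := (h0.exp).const_sub 1
  have h' : HasDerivAt (fun b : ℝ => gaussLayer b r)
      (-(Real.exp (-(β * r ^ 2 / 2)) * (-(r ^ 2 / 2)))) β := h
  exact h'.congr_deriv (by ring)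

/-- LOGISTIC BRACKET (c10 §3.1, first bracket of (3.1) with `K ≡ 1`). For a differentiable width `β(t)`, the full
residual `∂ₜ + (−a r)∂ᵣ − L` of `(t,r) ↦ g_{β(t)}(r)` equals `r² exp(−β r²/2) (β'/2 − a β + β²)` (`r ≠ 0`). -/
theorem logisticBracket (β : ℝ → ℝ) (β' a r t : ℝ) (hβ : HasDerivAt β β' t) (hr : r ≠ 0) :
    deriv (fun s => gaussLayer (β s) r) t
      + ((-(a * r)) * deriv (gaussLayer (β t)) r - radialOp (gaussLayer (β t)) r)
      = r ^ 2 * Real.exp (-(β t * r ^ 2 / 2)) * (β' / 2 - a * β t + β t ^ 2) := by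
  have hp : HasDerivAt (fun b : ℝ => gaussLayer b r) (r ^ 2 / 2 * Real.exp (-(β t * r ^ 2 / 2))) (β t) :=
    hasDerivAt_gaussLayer_param (β t) r
  have ht : HasDerivAt (fun s => gaussLayer (β s) r)
      (r ^ 2 / 2 * Real.exp (-(β t * r ^ 2 / 2)) * β') t := hp.comp t hβ
  rw [ht.deriv, strainResidual_gaussLayer a (β t) r hr]
  ring

/-- LOGISTIC LAW: if `β' ≤ 2β(a − β)` then the time-dependent layer is a subsolution (full residual `≤ 0`). -/
theorem logisticBracket_nonpos (β : ℝ → ℝ) (β' a r t : ℝ) (hβ : HasDerivAt β β' t) (hr : r ≠ 0)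
    (hlaw : β' ≤ 2 * β t * (a - β t)) :
    deriv (fun s => gaussLayer (β s) r) t
      + ((-(a * r)) * deriv (gaussLayer (β t)) r - radialOp (gaussLayer (β t)) r) ≤ 0 := by
  rw [logisticBracket β β' a r t hβ hr]
  have h1 : β' / 2 - a * β t + β t ^ 2 ≤ 0 := by nlinarith
  have h2 : 0 ≤ r ^ 2 * Real.exp (-(β t * r ^ 2 / 2)) := by positivity
  exact mul_nonpos_of_nonneg_of_nonpos h2 h1

/-- `0 ≤ g_β(r)` for `β ≥ 0`. -/
theorem gaussLayer_nonneg (β r : ℝ) (hβ : 0 ≤ β) : 0 ≤ gaussLayer β r := by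
  unfold gaussLayer
  have : Real.exp (-(β * r ^ 2 / 2)) ≤ 1 := by
    rw [Real.exp_le_one_iff]
    have : 0 ≤ β * r ^ 2 / 2 := by positivity
    linarith
  linarith

/-- `g_β(r) < 1` for all `β, r` (in particular the layer never exceeds its far-field value `1`). -/
theorem gaussLayer_lt_one (β r : ℝ) : gaussLayer β r < 1 := by
  unfold gaussLayer
  have := Real.exp_pos (-(β * r ^ 2 / 2))
  linarith

/-- `g_β` vanishes on the axis: `g_β(0) = 0`. -/
theorem gaussLayer_zero (β : ℝ) : gaussLayer β 0 = 0 := by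
  simp [gaussLayer]

/-- `ρ = r²` CALCULUS. If `f` has derivative `f'` everywhere and `f'` has derivative `f'' (r²)` at `r²`, then
`L (f ∘ (·)²)(r) = 4 r² f''(r²)` (`r ≠ 0`): radial profiles convex in `r²` are `L`-subsolutions-free (`L ≥ 0`). -/
theorem radialOp_comp_sq (f f' : ℝ → ℝ) (f'' r : ℝ) (hf : ∀ x, HasDerivAt f (f' x) x)
    (hf' : HasDerivAt f' f'' (r ^ 2)) (hr : r ≠ 0) :
    radialOp (fun x => f (x ^ 2)) r = 4 * r ^ 2 * f'' := by
  have hsq : ∀ y : ℝ, HasDerivAt (fun x : ℝ => x ^ 2) (2 * y) y := by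
    intro y; simpa using hasDerivAt_pow 2 y
  have h1 : ∀ y, HasDerivAt (fun x => f (x ^ 2)) (f' (y ^ 2) * (2 * y)) y := by
    intro y
    have hfy : HasDerivAt f (f' (y ^ 2)) ((fun x : ℝ => x ^ 2) y) := hf (y ^ 2)
    exact HasDerivAt.comp (h := fun x : ℝ => x ^ 2) (h₂ := f) y hfy (hsq y)
  have hd : deriv (fun x => f (x ^ 2)) = fun y => f' (y ^ 2) * (2 * y) := by
    funext y; exact (h1 y).deriv
  have h2 : HasDerivAt (fun y => f' (y ^ 2) * (2 * y))
      (f'' * (2 * r) * (2 * r) + f' (r ^ 2) * 2) r := by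
    have hf'2 : HasDerivAt f' f'' ((fun x : ℝ => x ^ 2) r) := hf'
    have ha : HasDerivAt (fun y => f' (y ^ 2)) (f'' * (2 * r)) r :=
      HasDerivAt.comp (h := fun x : ℝ => x ^ 2) (h₂ := f') r hf'2 (hsq r)
    have hb : HasDerivAt (fun y : ℝ => 2 * y) 2 r := by
      simpa using (hasDerivAt_id' r).const_mul (2 : ℝ)
    exact ha.mul hb
  unfold radialOp
  rw [hd, h2.deriv]
  field_simp
  ring

/-- PLANAR SINK = SHIFT IN `ρ = r²`. For the drift `b_r = −N²/r` and any `f` with derivative `f'` everywhere,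
`Γ(t,r) = f(r² + 2N²t)` satisfies the transport identity `∂ₜΓ + b_r ∂ᵣΓ = 0` (`r ≠ 0`). -/
theorem sinkTransport (f f' : ℝ → ℝ) (N r t : ℝ) (hf : ∀ x, HasDerivAt f (f' x) x) (hr : r ≠ 0) :
    deriv (fun s => f (r ^ 2 + 2 * N ^ 2 * s)) t
      + (-(N ^ 2 / r)) * deriv (fun x => f (x ^ 2 + 2 * N ^ 2 * t)) r = 0 := by
  have hs : HasDerivAt (fun s : ℝ => r ^ 2 + 2 * N ^ 2 * s) (2 * N ^ 2) t := by
    simpa using ((hasDerivAt_id' t).const_mul (2 * N ^ 2)).const_add (r ^ 2)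
  have hft : HasDerivAt f (f' (r ^ 2 + 2 * N ^ 2 * t)) ((fun s : ℝ => r ^ 2 + 2 * N ^ 2 * s) t) := hf _
  have ht : HasDerivAt (fun s => f (r ^ 2 + 2 * N ^ 2 * s)) (f' (r ^ 2 + 2 * N ^ 2 * t) * (2 * N ^ 2)) t :=
    hft.comp t hs
  have hx0 : HasDerivAt (fun x : ℝ => x ^ 2 + 2 * N ^ 2 * t) (2 * r) r := by
    simpa using (hasDerivAt_pow 2 r).add_const (2 * N ^ 2 * t)
  have hfr : HasDerivAt f (f' (r ^ 2 + 2 * N ^ 2 * t)) ((fun x : ℝ => x ^ 2 + 2 * N ^ 2 * t) r) := hf _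
  have hx : HasDerivAt (fun x => f (x ^ 2 + 2 * N ^ 2 * t)) (f' (r ^ 2 + 2 * N ^ 2 * t) * (2 * r)) r :=
    hfr.comp r hx0
  rw [ht.deriv, hx.deriv]
  field_simp
  ring

end

end Summit.NavierStokesRegularity.NavierStokesRegularity.Theorems
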